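import Mathlib.Analysis.Calculus.Gradient.Basic
import Mathlib.Analysis.InnerProductSpace.PiL2
import Mathlib.Algebra.Module.ZLattice.Basic
import Mathlib.Analysis.SpecialFunctions.Trigonometric.Basic
import Literature.Analysis.FunctionSpaces.HolderNorm
import HarnessLib

/-!
# Feldman–Salmhofer–Trubowitz II: the hypotheses (A1)–(A5), (A4′), (Sy)

Topic `Literature/MathematicalPhysics/QuantumLattice/FermiRG` (perturbation theory around non-nested Fermi
surfaces). This file types — STATEMENTS FIRST, nothing asserted — Chapter 2, §2.1–2.2 ("Definitions and
Assumptions") of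

* [II] J. Feldman, M. Salmhofer, E. Trubowitz, *Perturbation theory around non-nested Fermi surfaces II.
  Regularity of the moving Fermi surface: RPA contributions*, Comm. Pure Appl. Math. **51** (1998)
  1133–1246, arXiv:cond-mat/9701073 (`FeldmanSalmhoferTrubowitz1998`).

Locators `p.N Lm` are chunk `pNNNN.txt`, line `m`, of the `lit read arxiv:cond-mat/9701073` render of the
arXiv TeX (NOT journal pages); display labels `\EQN\foo` are quoted as `(foo)`. The printed assumption labels
are (A1)–(A5), (A4′) and (Sy) (TeX macros `\AOne{k,h} … \AFiv`, `\AFoup`, `\SYmm`).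

## Setting [II §2.1, p.6 L108–125]

Momentum space is `ℝ × 𝓑`, `𝓑 = E/Γ#` the torus of a `d`-dimensional real inner-product space `E` (`d ≥ 2`)
modulo the dual lattice `Γ#`, with a fundamental domain `F` (interior `F̊`); e.g. `Γ# = 2πℤ^d`,
`F = [-π, π)^d` (`Crystal.cubic`). The band structure (chemical potential included) is a `Γ#`-periodic
`e : E → ℝ`, the Fermi surface is `S = {p ∈ 𝓑 : e p = 0}`, and the two-body interaction is
`⟨p₂ p₄|V|p₁ p₃⟩ = v̂(p₂ - p₁)`, `v̂ : ℝ × 𝓑 → ℂ` [(twobodyint), p.7 L7]. The classes `C^{k,h}` are those of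
[II p.6 L88–104] (`k`-th derivatives `h`-Hölder, `C^{k,0} = C^k` with bounded derivatives): we use the tree's
`Literature.Analysis.FunctionSpaces.MemContDiffHolder k h` on the periodic lift.

## What is typed (DAG rows FST2.A1–A5 of the gate-hubbard-kl wave)

* `Crystal` (Γ#, F), `IsLatticePeriodic`, `fermiSurface`, `Crystal.fermiSurfaceRep` (= `S ∩ F`, the
  representatives through which [II] regards `S ⊂ 𝓑` as a subset of `ℝ^d`, cf. (A5)), `hessQuad`
  (the quadratic form of `e''`), `unitNormal`, `IsAntipode` / `IsAntipodalMapOn` (the antipode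
  `n(a(p)) = -n(p)`, p.7 L60–66), `levelCurvature`, `FermiCurveParam` (the `d = 2` angular coordinate `θ`,
  p.9 L40–62), `antipodeAngularDeriv` (`∂a/∂θ = κ(θ)/κ(a(θ))`, (curvratio) p.9 L121);
* the hypotheses as `Prop`-valued predicates on the data, never asserted: `HypA1` (A1)_{k,h}, `HypA2`
  (A2)_{k,h}, `HypA3` (A3), `HypSy` (Sy), `HypA4` (A4) = (upplo), `HypA4'` (A4′), `HypA5` (A5);
* `GeomConstants e K r₀ g₀ wmin`: the "elementary consequences" `|e|₂ ≤ K`, `|∇e| ≥ g₀` and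
  `w ≥ wmin` on `{|e| < r₀}` (p.7 L136–140, (gzerinit) p.8 L38, Lemma 2.1 = `\Lem\wBound` p.9 L1–35) on which
  the constants of all theorems of [II], [III] depend;
* `Crystal.cubic d`: `Γ# = 2πℤ^d`, `F = [-π, π)^d` (the example of p.6 L112–114), PROVED to be a crystal datum.

## Faithfulness notes (for the referee)

* (A3) "the curvature of `S` is strictly positive everywhere (matrix sense for `d > 2`)" is typed as strict
  positivity of `e''(p)` on the tangent space `∇e(p)^⊥`, `p ∈ S`, i.e. in the orientation in which the Fermi
  sea `{e < 0}` is the convex side ("the sign is `-1` if `e < 0` inside `S`", (frene) p.8 L168; it is the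
  reading under which [III §1 (3)] states `(∂_θ p, e''(p) ∂_θ p) ≥ w₀ > 0`); the opposite orientation is
  `HypA3 (-e)`. [II]'s further sentence "(A3) implies that `S` bounds a strictly convex set; in two
  dimensions `S` is a simple closed curve" is a consequence drawn in print, not part of the typed predicate.
* (A4) is typed literally as (upplo) for an antipodal self-map of `S ∩ F`; its existence and uniqueness is
  [II]'s consequence of (A3) (p.7 L60–66), so `HypA4` bundles `∃ a`. For symmetric `e`, `a = (p ↦ -p)` and
  (A4) "holds trivially" (p.7 L86).
* (A4′) is imposed in [II] only for `d = 2` and asymmetric `e`; it is typed over an explicit angular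
  coordinate (`FermiCurveParam`) with `∂a/∂θ` replaced by the curvature ratio it equals ((curvratio)).
* (A5) is typed in its printed SET form `{u p + v q : p, q ∈ S, u, v = ±1} ⊂ F̊` (p.7 L96) — NOT as a density
  window (referee trap (i)).

## What is NOT here

* Covariance, scale decomposition, renormalised expansion, the counterterm `K` and Theorems 1.1–1.3 of
  [II]: see `FST2Regularity.lean`.
* Any claim that a hypothesis holds for a model. In particular, for the Hubbard band
  `e(p) = -2(cos p₁ + cos p₂) - μ` [II p.7 L128] says (A5) "is fulfilled for densities `n < 0.369`"
  (⟺ `μ < -2`: the curve then lies in `|pᵢ| < π/2`, which is the tree's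
  `Literature.MathematicalPhysics.QuantumLattice.abs_le_umklappRadius_of_sqDispersion_eq` with
  `umklappRadius_lt_pi_div_two`; Cooper-disjointness below that density is
  `….umklapp_cooper_disjoint`). The Lean proof of "(A5) for the Hubbard band ⟺ `μ < -2`" is left to the
  programme's Fermi-surface seat; (A5) FAILS on the programme's window `μ ∈ [-0.43, -0.18]` and NOTHING in
  this file attaches (A5) to that window. [II] itself needs (A5) "only to prove statements about the
  second-order graph and the RPA graphs" (p.7 L130).
-/

noncomputable section

open Set Filter
open scoped NNReal Topology

namespace Literature.MathematicalPhysics.QuantumLattice.FermiRG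

open Literature.Analysis.FunctionSpaces (MemContDiffHolder)

/-! ### §1 The crystal datum and periodic functions [II §2.1, p.6 L108–125] -/

/-- FST2.setting · [II] §2.1 · p.6 L108–118. The crystal datum: momentum space is the torus `𝓑 = E/Γ#`
with `Γ#` the dual lattice of the position-space lattice `Γ` and `F ⊂ E` a fundamental domain for the
translation action of `Γ#` ("e.g. for `Γ = ℤ^d`, `𝓑 = ℝ^d/2πℤ^d`, `F = [-π,π)^d` and `F̊ = (-π,π)^d`").
We record `Γ#` as a discrete `ℤ`-submodule spanning `E` and `F` as a set of unique representatives.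
[cite: FeldmanSalmhoferTrubowitz1998, §2.1 (arXiv p.6 L108–118)] -/
structure Crystal (E : Type*) [NormedAddCommGroup E] [InnerProductSpace ℝ E] where
  /-- the dual lattice `Γ#` -/
  dualLattice : Submodule ℤ E
  /-- the fundamental domain `F` of the translation action of `Γ#` -/
  fundamentalDomain : Set E
  /-- `Γ#` is discrete -/
  discrete : DiscreteTopology dualLattice
  /-- `Γ#` spans `E` over `ℝ` -/
  span_eq_top : Submodule.span ℝ (dualLattice : Set E) = ⊤
  /-- every `p ∈ E` has exactly one `Γ#`-translate in `F` -/
  existsUnique_rep : ∀ p : E, ∃! g : dualLattice, p + (g : E) ∈ fundamentalDomain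

/-- FST2.setting · [II] §2.1 · p.7 L10. The Fermi surface `S = {p : e(p) = 0}` (as the periodic lift to `E`
of `S ⊂ 𝓑`; the chemical potential is included in `e`, p.6 L121).
[cite: FeldmanSalmhoferTrubowitz1998, §2.1 (arXiv p.7 L10)] -/
def fermiSurface {E : Type*} (e : E → ℝ) : Set E := {p | e p = 0}

/-- Membership in the Fermi surface is `e p = 0` ([II] §2.1, p.7 L10: `S = {p ∈ 𝓑 : e(p) = 0}`).
[cite: FeldmanSalmhoferTrubowitz1998, §2.1 (arXiv p.7 L10)] -/
@[simp] theorem mem_fermiSurface {E : Type*} {e : E → ℝ} {p : E} : p ∈ fermiSurface e ↔ e p = 0 :=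
  Iff.rfl

variable {E : Type*} [NormedAddCommGroup E] [InnerProductSpace ℝ E]

/-- FST2.setting · [II] §2.1 · p.6 L108–110. A function on the torus `𝓑 = E/Γ#`, recorded through its
periodic lift: `f (p + γ) = f p` for all `γ ∈ Γ#`.
[cite: FeldmanSalmhoferTrubowitz1998, §2.1 (arXiv p.6 L108–110)] -/
def IsLatticePeriodic (Γ : Submodule ℤ E) {α : Type*} (f : E → α) : Prop :=
  ∀ γ ∈ Γ, ∀ p : E, f (p + γ) = f p

/-- FST2.setting · [II] §2.1 · p.7 L96 with p.8 L3–5. The Fermi surface through its representatives in the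
fundamental domain, `S ∩ F`: [II] regards `S ⊂ 𝓑` as a subset of `ℝ^d` this way ("by (A5) … we may consider
`S` as a subset of `ℝ^d` instead of `𝓑`", p.8 L3–5), and (A4), (A4′), (A5) are conditions on this set.
[cite: FeldmanSalmhoferTrubowitz1998, §2.1 (arXiv p.7 L96, p.8 L3–5)] -/
def Crystal.fermiSurfaceRep (cr : Crystal E) (e : E → ℝ) : Set E :=
  fermiSurface e ∩ cr.fundamentalDomain

/-- Membership in `S ∩ F` is `e p = 0 ∧ p ∈ F` ([II] §2.1, p.7 L10 with p.7 L96).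
[cite: FeldmanSalmhoferTrubowitz1998, §2.1 (arXiv p.7 L10, L96)] -/
theorem Crystal.mem_fermiSurfaceRep {cr : Crystal E} {e : E → ℝ} {p : E} :
    p ∈ cr.fermiSurfaceRep e ↔ e p = 0 ∧ p ∈ cr.fundamentalDomain := Iff.rfl

/-! ### §2 Derivative objects: `e''`, the unit normal, the antipode, the curvature -/

/-- FST2.setting · [II] §2.2 · (edpdef)/(wpdef) p.8 L157–163. The quadratic form of the matrix of second
derivatives `e''(p)`, `v ↦ (v, e''(p) v)`, written with Mathlib's `iteratedFDeriv ℝ 2`; [II]'s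
`w(p) = (∂_θ p, e''(p) ∂_θ p)` is `hessQuad e p (∂_θ p)`.
[cite: FeldmanSalmhoferTrubowitz1998, §2.2 eq. (wpdef) (arXiv p.8 L157–163)] -/
def hessQuad (e : E → ℝ) (p v : E) : ℝ := iteratedFDeriv ℝ 2 e p ![v, v]

variable [CompleteSpace E]

/-- FST2.setting · [II] §2.1 · p.7 L59. The unit normal `n = ∇e/|∇e|` to the level sets of `e` (junk value
`0` where `∇e = 0`). [cite: FeldmanSalmhoferTrubowitz1998, §2.1 (arXiv p.7 L59)] -/
def unitNormal (e : E → ℝ) (p : E) : E := ‖gradient e p‖⁻¹ • gradient e p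

/-- FST2.setting · [II] §2.1 · p.7 L60–66. `q` is THE antipode `a(p)` of `p`: both lie on the Fermi surface
and the unit normals are opposite, `n(q) = -n(p)` ("strict convexity implies that this equation has, for
any `p ∈ S`, a unique solution `a(p) ∈ S`; necessarily `a(p) ≠ p`; `a ∈ C^{k-1}(S,S)`"; for symmetric `e`,
`a(p) = -p`, p.7 L70). [cite: FeldmanSalmhoferTrubowitz1998, §2.1 (arXiv p.7 L60–66)] -/
def IsAntipode (e : E → ℝ) (p q : E) : Prop :=
  p ∈ fermiSurface e ∧ q ∈ fermiSurface e ∧ unitNormal e q = -unitNormal e p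

/-- FST2.setting · [II] §2.1 · p.7 L60–66. `a` is an antipodal map of the set `S` (in [II], `S ∩ F`): it maps
`S` to itself and `a p` is an antipode of every `p ∈ S`.
[cite: FeldmanSalmhoferTrubowitz1998, §2.1 (arXiv p.7 L60–66)] -/
def IsAntipodalMapOn (e : E → ℝ) (S : Set E) (a : E → E) : Prop :=
  ∀ p ∈ S, a p ∈ S ∧ IsAntipode e p (a p)

/-- FST2.setting · [II] §2.2 · Lemma 2.1 (`\Lem\wBound`) p.9 L1–4 with (curvratio) p.9 L121. The curvature of
the level set of `e` through `p` in the normalisation of [II, d = 2]: `κ(p) |∇e(p)| = (t, e''(p) t)` for the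
unit tangent `t` (Lemma 2.1: `κ |∇e| = ∓ w/|∂_θ p|²`, sign as in (frene), `e < 0` inside). Typed
dimension-free as the supremum of `(v, e''(p) v)/|∇e(p)|` over unit tangent vectors `v ⊥ ∇e(p)`: for
`d = 2` that set is `{t, -t}` and the supremum is the common value; for `d ≥ 3` it is the largest normal
curvature (junk if `∇e(p) = 0`). [cite: FeldmanSalmhoferTrubowitz1998, Lemma 2.1 (arXiv p.9 L1–4)] -/
def levelCurvature (e : E → ℝ) (p : E) : ℝ :=
  sSup ((fun v : E => hessQuad e p v / ‖gradient e p‖) '' {v | ‖v‖ = 1 ∧ inner ℝ (gradient e p) v = 0})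

/-! ### §3 The hypotheses (A1)–(A3), (Sy) [II §2.1, p.7 L11–70] -/

/-- FST2.A1 · [II] Assumption (A1)_{k,h} · p.7 L11–35 ((evenv), (contildev), (UVdecay)). On the interaction
`v̂ : ℝ × 𝓑 → ℂ` (recorded through its `Γ#`-periodic lift in the spatial variable): `v̂ ∈ C^{k,h}(ℝ × 𝓑, ℂ)`
with all derivatives of order at most `k` uniformly bounded; the reality condition
`v̂(-p₀, p) = conj (v̂(p₀, p))` (evenv); a bounded real-valued `C^{k,h}` function `ṽ` with
`lim_{p₀ → ∞} v̂(p₀, p) = ṽ(p)` (contildev); and constants `α, K₀, π₀ > 0` with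
`|v̂(p₀, p) - ṽ(p)| ≤ K₀ |p₀|^{-α}` for all `|p₀| ≥ π₀`, all `p` (UVdecay) (which, with (evenv), also
gives the limit at `-∞`, p.7 L37). A predicate, never asserted.
[cite: FeldmanSalmhoferTrubowitz1998, Assumption A1 (arXiv p.7 L11–35)] -/
structure HypA1 (cr : Crystal E) (k : ℕ) (h : ℝ≥0) (v : ℝ × E → ℂ) : Prop where
  /-- `v̂` is a function on `ℝ × 𝓑` -/
  periodic : ∀ γ ∈ cr.dualLattice, ∀ (p₀ : ℝ) (p : E), v (p₀, p + γ) = v (p₀, p)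
  /-- `v̂ ∈ C^{k,h}(ℝ × 𝓑, ℂ)`, derivatives of order `≤ k` uniformly bounded -/
  memContDiffHolder : MemContDiffHolder k h v
  /-- (evenv) `v̂(-p₀, p) = conj (v̂(p₀, p))` -/
  conj_eq : ∀ (p₀ : ℝ) (p : E), v (-p₀, p) = starRingEnd ℂ (v (p₀, p))
  /-- (contildev) and (UVdecay): the `p₀ → ∞` limit `ṽ ∈ C^{k,h}(𝓑, ℝ)` and the power-law approach -/
  uv_limit : ∃ vInf : E → ℝ, MemContDiffHolder k h vInf ∧
      (∀ p : E, Tendsto (fun p₀ : ℝ => v (p₀, p)) atTop (𝓝 (vInf p : ℂ))) ∧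
      ∃ α K₀ π₀ : ℝ, 0 < α ∧ 0 < K₀ ∧ 0 < π₀ ∧
        ∀ (p₀ : ℝ) (p : E), π₀ ≤ |p₀| → ‖v (p₀, p) - (vInf p : ℂ)‖ ≤ K₀ * |p₀| ^ (-α)

/-- FST2.A2 · [II] Assumption (A2)_{k,h} · p.7 L53–54. On the band structure: `e ∈ C^{k,h}(𝓑, ℝ)` (recorded
through its `Γ#`-periodic lift) and `∇e(p) ≠ 0` for all `p ∈ S` (so `S` is a compact `C^k` submanifold of
`𝓑`, p.7 L55–58). A predicate, never asserted; for the Hubbard band the non-vanishing of `∇e` on the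
curve is the tree's `HubbardFermiVelocity.lean` (to be cited by the instantiating file, not restated).
[cite: FeldmanSalmhoferTrubowitz1998, Assumption A2 (arXiv p.7 L53–54)] -/
structure HypA2 (cr : Crystal E) (k : ℕ) (h : ℝ≥0) (e : E → ℝ) : Prop where
  /-- `e` is a function on `𝓑` -/
  periodic : IsLatticePeriodic cr.dualLattice e
  /-- `e ∈ C^{k,h}(𝓑, ℝ)` -/
  memContDiffHolder : MemContDiffHolder k h e
  /-- `∇e ≠ 0` on the Fermi surface -/
  gradient_ne_zero : ∀ p ∈ fermiSurface e, gradient e p ≠ 0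

/-- FST2.A3 · [II] Assumption (A3) · p.7 L58–59. "The curvature `κ` of `S` is strictly positive everywhere; in
`d > 2` this is meant in the matrix sense": the second fundamental form of `S` is definite, typed as strict
positivity of `(v, e''(p) v)` for every non-zero tangent vector `v ⊥ ∇e(p)`, `p ∈ S` — the orientation in
which the Fermi sea `{e < 0}` is the convex side ((frene) p.8 L168 "the sign is `-1` if `e < 0` inside
`S`"; [III §1 (3)]); the other orientation is `HypA3 (fun p ↦ -e p)`. [II] adds that (A3) "implies that `S`
bounds a strictly convex set; in two dimensions, `S` is a simple closed curve" — a consequence stated in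
print, not part of this predicate. For the Hubbard band at `-4 < μ < 0` this is the tree's
`HubbardFermiBandCurvature.bandHess_pos` (to be cited by the instantiating file).
[cite: FeldmanSalmhoferTrubowitz1998, Assumption A3 (arXiv p.7 L58–59)] -/
def HypA3 (e : E → ℝ) : Prop :=
  ∀ p ∈ fermiSurface e, ∀ v : E, v ≠ 0 → inner ℝ (gradient e p) v = 0 → 0 < hessQuad e p v

omit [CompleteSpace E] in
/-- FST2.Sy · [II] (Sy) · p.7 L67–70. "`e` is symmetric if `e(-p) = e(p)` for all `p ∈ 𝓑`, and asymmetric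
otherwise; if (Sy) holds, `a(p) = -p`." [cite: FeldmanSalmhoferTrubowitz1998, §2.1 hypothesis (Sy) (arXiv p.7 L67–70)] -/
def HypSy (e : E → ℝ) : Prop := ∀ p : E, e (-p) = e p

/-! ### §4 The antipodal hypotheses (A4), (A4′) [II p.7 L71–95, §2.2–2.3 p.9 L40–160] -/

/-- FST2.A4 · [II] Assumption (A4) · eq. (upplo) p.7 L71–85 (imposed "in the asymmetric case"; "if `e` is
symmetric, (A4) holds trivially by (Sy): the left hand side of (upplo) is zero", p.7 L86). For all curves
`t ↦ p(t)` in `S`: `|1 - |∂p/∂t|⁻¹ |∂ a(p(t))/∂t|| ≤ 1/8`, `a` the antipodal map ("essentially, the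
curvature at `p` and `a(p)` must not differ by too much"; "the number `1/8` is certainly not optimal",
p.7 L110). Typed for an antipodal self-map `a` of `S ∩ F`, whose existence (A3) guarantees in [II]
(p.7 L60–66) and which we therefore quantify existentially, and for every curve in `S ∩ F` differentiable
at `t` with non-zero velocity along which `a ∘ p` is differentiable at `t` (in [II], `a ∈ C^{k-1}`). In the
`d = 2` coordinate `θ` this is `7/8 ≤ ∂a/∂θ ≤ 9/8` ((antidel) p.9 L111) with `∂a/∂θ = κ(θ)/κ(a(θ))`
((curvratio) p.9 L121); the `d ≥ 3` matrix consequence is §2.3, p.9 L150–160.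
[cite: FeldmanSalmhoferTrubowitz1998, Assumption A4 eq. (upplo) (arXiv p.7 L71–85)] -/
def HypA4 (cr : Crystal E) (e : E → ℝ) : Prop :=
  ∃ a : E → E, IsAntipodalMapOn e (cr.fermiSurfaceRep e) a ∧
    ∀ (γ : ℝ → E) (t : ℝ) (γ' b : E), (∀ s, γ s ∈ cr.fermiSurfaceRep e) →
      HasDerivAt γ γ' t → HasDerivAt (a ∘ γ) b t → γ' ≠ 0 → |1 - ‖γ'‖⁻¹ * ‖b‖| ≤ 1 / 8

/-- FST2.setting · [II] §2.2 (Two Dimensions) · p.9 L40–62 (summary (2.?) "`θ ∈ ℝ/2πℤ`,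
`|∂_θ p(0, θ)| = 1/P`"). The angular coordinate on the Fermi curve for `d = 2`: a `2π`-periodic
parametrisation `θ ↦ p(0, θ)` of `S ∩ F` (a simple closed curve, p.7 L60), injective on a period, with
velocity of constant length `1/P` (a multiple of arclength, `P` chosen so that the period is `2π`). In [II]
it is CONSTRUCTED from the coordinates of [I, Lemma 2.1]; here it is data that the `d = 2` asymmetric
hypothesis (A4′) refers to. [cite: FeldmanSalmhoferTrubowitz1998, §2.2 (arXiv p.9 L40–62)] -/
structure FermiCurveParam (cr : Crystal E) (e : E → ℝ) where
  /-- `θ ↦ p(0, θ)` -/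
  γ : ℝ → E
  /-- `θ ↦ ∂_θ p(0, θ)` -/
  dγ : ℝ → E
  /-- the normalisation constant `P` -/
  P : ℝ
  P_pos : 0 < P
  periodic : Function.Periodic γ (2 * Real.pi)
  mem : ∀ θ, γ θ ∈ cr.fermiSurfaceRep e
  surjOn : cr.fermiSurfaceRep e ⊆ γ '' Ico 0 (2 * Real.pi)
  injOn : InjOn γ (Ico 0 (2 * Real.pi))
  hasDerivAt : ∀ θ, HasDerivAt γ (dγ θ) θ
  norm_dγ : ∀ θ, ‖dγ θ‖ = P⁻¹

/-- FST2.setting · [II] §2.2 · (curvratio) p.9 L117–123 (with (antidef), (antidel), (deltwop)). The derivative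
`∂a/∂θ` of the angular antipode, in the form [II] derives and uses: "by choice of the coordinate `θ`,
`∂a/∂θ = |∂²_θ p(0,θ)|/|∂²_θ p(0,a(θ))| = κ(0,θ)/κ(0,a(θ))` — thus (A4) is simply a condition on the ratio
of the curvatures at `p` and its antipode". [cite: FeldmanSalmhoferTrubowitz1998, §2.2 eq. (curvratio) (arXiv p.9 L117–123)] -/
def antipodeAngularDeriv {cr : Crystal E} (e : E → ℝ) (a : E → E) (Θ : FermiCurveParam cr e) (θ : ℝ) : ℝ :=
  levelCurvature e (Θ.γ θ) / levelCurvature e (a (Θ.γ θ))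

/-- FST2.A4 (second half) · [II] Assumption (A4′) (`\hypit{\AFoup}`) · §2.3 p.9 L127–139, imposed "for `d = 2`
and `e` not obeying (Sy)". With `Z = {θ⁽¹⁾, …, θ⁽ᴺ⁾}` the points of a period where `∂a/∂θ = 1`: `Z` is
finite; there is `δ₀ > 0` such that the `2δ₀`-neighbourhoods of distinct points of `Z` (on `ℝ/2πℤ`) are
disjoint, `∂a/∂θ` is monotonic on each `U_{2δ₀}(θ⁽ᵏ⁾)`, and there is `K_a > 0` with
`|∂a/∂θ(θ) - ∂a/∂θ(θ')| ≥ K_a |θ - θ'|` for all `θ, θ' ∈ U_{δ₀}(θ⁽ᵏ⁾)`, all `k`. ([II] p.9 L140–149: such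
points must exist for asymmetric `e`; (A4′) is used only in the proof of Theorem 1.3 (ii), in the one-loop
volume estimate bounding the particle–particle ladder when (Sy) fails.) Typed over an angular coordinate
`Θ` and an antipodal map `a`, with `∂a/∂θ` the curvature ratio `antipodeAngularDeriv` ((curvratio)).
[cite: FeldmanSalmhoferTrubowitz1998, Assumption A4' (arXiv p.9 L127–139)] -/
def HypA4' {cr : Crystal E} (e : E → ℝ) (a : E → E) (Θ : FermiCurveParam cr e) : Prop :=
  ∃ Z : Finset ℝ, (↑Z : Set ℝ) ⊆ Ico 0 (2 * Real.pi) ∧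
    (∀ θ ∈ Ico (0 : ℝ) (2 * Real.pi), antipodeAngularDeriv e a Θ θ = 1 ↔ θ ∈ Z) ∧
    ∃ δ₀ : ℝ, 0 < δ₀ ∧
      (∀ z ∈ Z, ∀ z' ∈ Z, ∀ n : ℤ, (z ≠ z' ∨ n ≠ 0) →
        Disjoint (Metric.ball z (2 * δ₀)) (Metric.ball (z' + n * (2 * Real.pi)) (2 * δ₀))) ∧
      (∀ z ∈ Z, MonotoneOn (antipodeAngularDeriv e a Θ) (Metric.ball z (2 * δ₀)) ∨
        AntitoneOn (antipodeAngularDeriv e a Θ) (Metric.ball z (2 * δ₀))) ∧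
      ∃ Ka : ℝ, 0 < Ka ∧ ∀ z ∈ Z, ∀ θ ∈ Metric.ball z δ₀, ∀ θ' ∈ Metric.ball z δ₀,
        Ka * |θ - θ'| ≤ |antipodeAngularDeriv e a Θ θ - antipodeAngularDeriv e a Θ θ'|

/-! ### §5 The filling hypothesis (A5) [II p.7 L95–96, L125–135] -/

omit [CompleteSpace E] in
/-- FST2.A5 · [II] Assumption (A5) · p.7 L95–96: `{u p + v q : p, q ∈ S, u, v = ±1} ⊂ F̊`, `S` through its
representatives in the fundamental domain `F`, `F̊` the interior. "(A5) restricts the density to be small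
enough, to avoid certain umklapp processes. E.g. in the Hubbard model, `e(p) = -2(cos p₁ + cos p₂) - μ`,
this is fulfilled for densities `n < 0.369` (`n = 1` is half-filling). We need (A5) only to prove
statements about the second-order graph and the RPA graphs" (p.7 L125–131); its first consequence is
Lemma 2.1 of [II] (no three collinear points of `S`; the longest chord, p.7 L141–p.8 L35). Typed in the
printed set form; NOT a density or `μ` window, and asserted for no model here (for the Hubbard band it
holds iff `μ < -2`, and it FAILS on the doping window of the Kohn–Luttinger programme).
[cite: FeldmanSalmhoferTrubowitz1998, Assumption A5 (arXiv p.7 L95–96)] -/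
def HypA5 (cr : Crystal E) (e : E → ℝ) : Prop :=
  ∀ p ∈ cr.fermiSurfaceRep e, ∀ q ∈ cr.fermiSurfaceRep e, ∀ u v : ℝ,
    (u = 1 ∨ u = -1) → (v = 1 ∨ v = -1) → u • p + v • q ∈ interior cr.fundamentalDomain

/-! ### §6 The geometric constants `|e|₂, r₀, g₀, w` [II p.2 L150, p.7 L136–140, p.8 L38–75, p.9 L1–75] -/

/-- FST2.constants · [II] §2.1–2.2 · p.7 L136–140, (gzerinit) p.8 L38–41, Lemma 2.1 (`\Lem\wBound`) p.9 L1–12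
and (wz) p.9 L73–75; the norm `|e|₂ = sup_p Σ_{|α| ≤ 2} |D^α e(p)|` of p.2 L150. The numbers on which "the
constant `Q_V` depends only" (Theorem 1.1) and likewise all constants of [II], [III]: a bound `K` for the
derivatives of `e` of order `≤ 2`; a width `r₀ > 0` and `g₀ > 0` with `|∇e(p)| ≥ g₀` on the neighbourhood
`{|e| < r₀}` of `S` ((A2) and compactness, p.7 L136–140; [II] phrases it on `|ρ| < r₀` in the coordinates
`e(p(ρ,θ)) = ρ`); and the curvature constant of Lemma 2.1: `(t, e''(p) t) ≥ wmin |t|²` for tangent vectors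
`t ⊥ ∇e(p)` at points with `|e(p)| < r₀` (Lemma 2.1: `|w(p(ρ,θ))| ≥ wmin |∂_θ p(ρ,θ)|²`,
`wmin = κ₀ g₀`; [II]'s `w₀ = wmin/P²` of (wz) is this constant times the fixed normalisation `P⁻²` of the
angular coordinate). Sign as in `HypA3`. A predicate recording that `(K, r₀, g₀, wmin)` are valid constants
for `e`; never asserted. [cite: FeldmanSalmhoferTrubowitz1998, Lemma 2.1 and eqs. (gzerinit), (wz) (arXiv p.8 L38–41, p.9 L1–75)] -/
structure GeomConstants (e : E → ℝ) (K r₀ g₀ wmin : ℝ) : Prop where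
  r₀_pos : 0 < r₀
  g₀_pos : 0 < g₀
  wmin_pos : 0 < wmin
  /-- `|e|₂ ≤ K`: all derivatives of order `≤ 2` bounded by `K` -/
  norm_iteratedFDeriv_le : ∀ p : E, ∀ j ≤ 2, ‖iteratedFDeriv ℝ j e p‖ ≤ K
  /-- (gzerinit) `|∇e| ≥ g₀` on `{|e| < r₀}` -/
  le_norm_gradient : ∀ p : E, |e p| < r₀ → g₀ ≤ ‖gradient e p‖
  /-- Lemma 2.1 / (wz): `(t, e'' t) ≥ wmin |t|²` for tangent `t` on `{|e| < r₀}` -/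
  le_hessQuad : ∀ p : E, |e p| < r₀ → ∀ t : E, inner ℝ (gradient e p) t = 0 → wmin * ‖t‖ ^ 2 ≤ hessQuad e p t

/-! ### §7 The example `Γ# = 2πℤ^d`, `F = [-π, π)^d` [II p.6 L112–114] -/

namespace Crystal

/-- The basis `(2π eᵢ)ᵢ` of `ℝ^d` generating the dual lattice `2πℤ^d` of `ℤ^d`. [folklore] -/
def cubicBasis (d : ℕ) : Module.Basis (Fin d) ℝ (EuclideanSpace ℝ (Fin d)) :=
  (EuclideanSpace.basisFun (Fin d) ℝ).toBasis.isUnitSMul (w := fun _ => 2 * Real.pi)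
    (fun _ => isUnit_iff_ne_zero.2 (by positivity))

/-- `cubicBasis d i = 2π eᵢ` (plumbing for `Crystal.cubic`). [folklore] -/
private theorem cubicBasis_apply (d : ℕ) (i : Fin d) :
    cubicBasis d i = (2 * Real.pi) • EuclideanSpace.basisFun (Fin d) ℝ i := by
  simp [cubicBasis, Module.Basis.isUnitSMul_apply]

/-- Coordinates in the basis `(2π eᵢ)`: `(2π)⁻¹ pᵢ` (plumbing for `Crystal.cubic`). [folklore] -/
private theorem cubicBasis_repr (d : ℕ) (p : EuclideanSpace ℝ (Fin d)) (i : Fin d) :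
    (cubicBasis d).repr p i = (2 * Real.pi)⁻¹ * p i := by
  have h2 : IsUnit (2 * Real.pi) := isUnit_iff_ne_zero.2 (by positivity)
  rw [cubicBasis, Module.Basis.repr_isUnitSMul, OrthonormalBasis.coe_toBasis_repr_apply,
    EuclideanSpace.basisFun_repr, Units.smul_def, smul_eq_mul, Units.val_inv_eq_inv_val, IsUnit.unit_spec]

/-- FST2.setting · [II] §2.1 · p.6 L112–114: "for `Γ = ℤ^d`, `𝓑 = ℝ^d/2πℤ^d`, `F = [-π, π)^d` and
`F̊ = (-π, π)^d`" — the cubic crystal datum (the one of the Hubbard model), with the lattice and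
unique-representative properties PROVED. [cite: FeldmanSalmhoferTrubowitz1998, §2.1 (arXiv p.6 L112–114)] -/
def cubic (d : ℕ) : Crystal (EuclideanSpace ℝ (Fin d)) where
  dualLattice := Submodule.span ℤ (Set.range (cubicBasis d))
  fundamentalDomain := {p | ∀ i, -Real.pi ≤ p i ∧ p i < Real.pi}
  discrete := inferInstance
  span_eq_top := ZSpan.span_top (cubicBasis d)
  existsUnique_rep := by
    intro p
    -- shift by `c = (π, …, π)`: `p + g ∈ [-π,π)^d ↔ g +ᵥ (p + c) ∈ [0, 2π)^d = ZSpan.fundamentalDomain`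
    let c : EuclideanSpace ℝ (Fin d) := WithLp.toLp 2 (fun _ => Real.pi)
    have key : ∀ g : Submodule.span ℤ (Set.range (cubicBasis d)),
        p + (g : EuclideanSpace ℝ (Fin d)) ∈ {p : EuclideanSpace ℝ (Fin d) | ∀ i, -Real.pi ≤ p i ∧ p i < Real.pi}
          ↔ g +ᵥ (p + c) ∈ ZSpan.fundamentalDomain (cubicBasis d) := by
      intro g
      rw [ZSpan.mem_fundamentalDomain, Set.mem_setOf_eq]
      refine forall_congr' fun i => ?_
      have hvadd : (g +ᵥ (p + c) : EuclideanSpace ℝ (Fin d)) = (g : EuclideanSpace ℝ (Fin d)) + (p + c) := rfl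
      rw [hvadd, cubicBasis_repr, Set.mem_Ico]
      have hc : c i = Real.pi := rfl
      simp only [PiLp.add_apply, hc]
      have hπ : 0 < 2 * Real.pi := by positivity
      constructor
      · rintro ⟨h1, h2⟩
        constructor
        · exact mul_nonneg (inv_nonneg.2 hπ.le) (by linarith)
        · rw [inv_mul_lt_iff₀ hπ]; linarith
      · rintro ⟨h1, h2⟩
        have h1' : 0 ≤ (g : EuclideanSpace ℝ (Fin d)) i + (p i + Real.pi) := by
          by_contra hneg
          push Not at hneg
          have : (2 * Real.pi)⁻¹ * ((g : EuclideanSpace ℝ (Fin d)) i + (p i + Real.pi)) < 0 :=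
            mul_neg_of_pos_of_neg (inv_pos.2 hπ) hneg
          linarith
        rw [inv_mul_lt_iff₀ hπ] at h2
        constructor <;> linarith
    exact (existsUnique_congr key).2 (ZSpan.exist_unique_vadd_mem_fundamentalDomain (cubicBasis d) (p + c))

end Crystal

end Literature.MathematicalPhysics.QuantumLattice.FermiRG

end
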